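import Mathlib
import HarnessLib

/-!
# The Brascamp–Lieb variance inequality in dimension one

`Literature/Probability/Distributions/`. The one-dimensional case of Brascamp–Lieb 1976,
Theorem 4.1 (J. Funct. Anal. 22, proof on p. 377): for `F = e^{-f}` on `ℝ` with `f ∈ C²`,
`f'' > 0` and `f` attaining its minimum at `a`, and for `h ∈ C¹(ℝ)`,

  `∫ (h - h a)² F dx ≤ ∫ (h')² / f'' F dx`,

hence `var h ≤ ⟨(h - h a)²⟩ ≤ ⟨(h')²/f''⟩` for the probability measure `F dx / ∫ F`.

The printed proof writes `h - h(a) = f' k` and integrates by parts. We run the same computation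
in the form of a pointwise derivative inequality: for `φ := (h - h a)² F / f'` (on `f' ≠ 0`),

  `φ' = (h')² F / f'' - (h - h a)² F - F (h' f' - (h - h a) f'')² / (f'' f'²) ≤ (h')² F/f'' - (h - h a)² F`,

integrate it over `[s, R] ⊂ (a, ∞)` (and symmetrically on `(-∞, a)`), discard `φ(R) ≥ 0`, and let
`R → ∞`, `s → a⁺`, using `φ(s) → 0` (both `(h s - h a)/(s - a)` and `f' s/(s - a)` converge, the
latter to `f'' a > 0`). No boundary terms at infinity are needed. This file is theorems only; it is
the analytic base step used in every induction step of the `n`-dimensional theorem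
(`BrascampLieb1976_thm41`).

References: H. J. Brascamp, E. H. Lieb, J. Funct. Anal. 22 (1976) 366–389, Thm 4.1 (proof for
`ℝ¹`, p. 377). [BrascampLieb1976]
-/

noncomputable section

open MeasureTheory ProbabilityTheory Filter Set Topology
open scoped ENNReal NNReal Topology

namespace Literature.Probability.Distributions

namespace BrascampLiebDimOne

/-! ### Pointwise calculus -/

/-- Derivative of `φ = (h - h a)² e^{-f} / f'` at a point where `f' ≠ 0`. [folklore] -/
theorem hasDerivAt_phi {f f' f'' h h' : ℝ → ℝ} {a x : ℝ}
    (hf : HasDerivAt f (f' x) x) (hf' : HasDerivAt f' (f'' x) x) (hh : HasDerivAt h (h' x) x)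
    (hx : f' x ≠ 0) :
    HasDerivAt (fun y => (h y - h a) ^ 2 * Real.exp (-f y) / f' y)
      (((2 * (h x - h a) * h' x * Real.exp (-f x) + (h x - h a) ^ 2 * (-f' x * Real.exp (-f x)))
          * f' x - (h x - h a) ^ 2 * Real.exp (-f x) * f'' x) / (f' x) ^ 2) x := by
  have h1 : HasDerivAt (fun y => (h y - h a) ^ 2) (2 * (h x - h a) * h' x) x :=
    ((hh.sub_const (h a)).fun_pow 2).congr_deriv (by norm_num)
  have h2 : HasDerivAt (fun y => Real.exp (-f y)) (-f' x * Real.exp (-f x)) x := by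
    have := hf.neg.exp
    simpa [mul_comm] using this
  exact (h1.mul h2).div hf' hx

/-- The algebra behind the integration by parts on p. 377 of Brascamp–Lieb: with `E = e^{-f} > 0`,
`G = f'' > 0`, `F = f' ≠ 0`, `u = h - h(a)`, `v = h'`,
`φ' = ((2uvE - u²FE)F - u²EG)/F² ≤ v²E/G - u²E`, the difference being `E (vF - uG)²/(G F²)`.
[cite: BrascampLieb1976, Thm 4.1 (proof, p. 377)] -/
theorem deriv_phi_le {u v E F G : ℝ} (hE : 0 < E) (hF : F ≠ 0) (hG : 0 < G) :
    ((2 * u * v * E + u ^ 2 * (-F * E)) * F - u ^ 2 * E * G) / F ^ 2 ≤ v ^ 2 / G * E - u ^ 2 * E := by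
  have hF2 : 0 < F ^ 2 := by positivity
  have key : v ^ 2 / G * E - u ^ 2 * E
      - ((2 * u * v * E + u ^ 2 * (-F * E)) * F - u ^ 2 * E * G) / F ^ 2
      = E * (v * F - u * G) ^ 2 / (G * F ^ 2) := by
    field_simp
    ring
  have hnn : 0 ≤ E * (v * F - u * G) ^ 2 / (G * F ^ 2) := by positivity
  linarith

/-! ### The setting of Theorem 4.1 in one dimension -/

section Setting

variable {f f' f'' h h' : ℝ → ℝ} {a : ℝ}

/-- At a global minimum the derivative vanishes. [folklore] -/
theorem deriv_eq_zero_of_min (hf : ∀ x, HasDerivAt f (f' x) x) (ha : ∀ x, f a ≤ f x) :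
    f' a = 0 :=
  IsLocalMin.hasDerivAt_eq_zero (Filter.Eventually.of_forall ha) (hf a)

/-- For `x > a` (the minimum), `f' x > 0`. [folklore] -/
theorem deriv_pos_of_gt (hf : ∀ x, HasDerivAt f (f' x) x) (hf' : ∀ x, HasDerivAt f' (f'' x) x)
    (hpos : ∀ x, 0 < f'' x) (ha : ∀ x, f a ≤ f x) {x : ℝ} (hx : a < x) : 0 < f' x := by
  have := strictMono_of_hasDerivAt_pos hf' hpos hx
  rwa [deriv_eq_zero_of_min hf ha] at this

/-- For `x < a` (the minimum), `f' x < 0`. [folklore] -/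
theorem deriv_neg_of_lt (hf : ∀ x, HasDerivAt f (f' x) x) (hf' : ∀ x, HasDerivAt f' (f'' x) x)
    (hpos : ∀ x, 0 < f'' x) (ha : ∀ x, f a ≤ f x) {x : ℝ} (hx : x < a) : f' x < 0 := by
  have := strictMono_of_hasDerivAt_pos hf' hpos hx
  rwa [deriv_eq_zero_of_min hf ha] at this

/-- `f' x ≠ 0` for `x ≠ a`. [folklore] -/
theorem deriv_ne_zero_of_ne (hf : ∀ x, HasDerivAt f (f' x) x) (hf' : ∀ x, HasDerivAt f' (f'' x) x)
    (hpos : ∀ x, 0 < f'' x) (ha : ∀ x, f a ≤ f x) {x : ℝ} (hx : x ≠ a) : f' x ≠ 0 := by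
  rcases lt_or_gt_of_ne hx with h | h
  · exact (deriv_neg_of_lt hf hf' hpos ha h).ne
  · exact (deriv_pos_of_gt hf hf' hpos ha h).ne'

/-- The integration-by-parts inequality on a compact interval `[p, q]` not containing the minimum:
`φ q - φ p ≤ ∫_p^q (h')²e^{-f}/f'' - ∫_p^q (h - h a)² e^{-f}`, `φ = (h - h a)² e^{-f}/f'`.
[cite: BrascampLieb1976, Thm 4.1 (proof, p. 377)] -/
theorem phi_sub_phi_le (hf : ∀ x, HasDerivAt f (f' x) x) (hf' : ∀ x, HasDerivAt f' (f'' x) x)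
    (hf'' : Continuous f'') (hpos : ∀ x, 0 < f'' x)
    (hh : ∀ x, HasDerivAt h (h' x) x) (hh' : Continuous h') {p q : ℝ} (hpq : p ≤ q)
    (hne : ∀ x ∈ Icc p q, f' x ≠ 0) :
    (h q - h a) ^ 2 * Real.exp (-f q) / f' q - (h p - h a) ^ 2 * Real.exp (-f p) / f' p ≤
      (∫ x in p..q, (h' x) ^ 2 / f'' x * Real.exp (-f x)) -
        ∫ x in p..q, (h x - h a) ^ 2 * Real.exp (-f x) := by
  have hfc : Continuous f := continuous_iff_continuousAt.2 fun x => (hf x).continuousAt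
  have hhc : Continuous h := continuous_iff_continuousAt.2 fun x => (hh x).continuousAt
  have hψ : Continuous fun x => (h' x) ^ 2 / f'' x * Real.exp (-f x) - (h x - h a) ^ 2 * Real.exp (-f x) := by
    have h1 : Continuous fun x => (h' x) ^ 2 / f'' x :=
      (hh'.pow 2).div hf'' fun x => (hpos x).ne'
    fun_prop
  have hc1 : Continuous fun x => (h' x) ^ 2 / f'' x * Real.exp (-f x) := by
    have h1 : Continuous fun x => (h' x) ^ 2 / f'' x :=
      (hh'.pow 2).div hf'' fun x => (hpos x).ne'
    fun_prop
  have hc2 : Continuous fun x => (h x - h a) ^ 2 * Real.exp (-f x) := by fun_prop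
  have key := intervalIntegral.sub_le_integral_of_hasDeriv_right_of_le hpq
    (g := fun y => (h y - h a) ^ 2 * Real.exp (-f y) / f' y)
    (φ := fun x => (h' x) ^ 2 / f'' x * Real.exp (-f x) - (h x - h a) ^ 2 * Real.exp (-f x))
    (fun x hx => (hasDerivAt_phi (hf x) (hf' x) (hh x) (hne x hx)).continuousAt.continuousWithinAt)
    (fun x hx => (hasDerivAt_phi (hf x) (hf' x) (hh x)
      (hne x (Ioo_subset_Icc_self hx))).hasDerivWithinAt)
    (hψ.integrableOn_Icc)
    (fun x hx => deriv_phi_le (Real.exp_pos _) (hne x (Ioo_subset_Icc_self hx)) (hpos x))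
  rw [intervalIntegral.integral_sub (hc1.intervalIntegrable _ _) (hc2.intervalIntegrable _ _)] at key
  exact key

/-- Right of the minimum: for `a < s ≤ R`,
`∫_s^R (h - h a)² e^{-f} ≤ ∫_s^R (h')² e^{-f}/f'' + φ s`. [cite: BrascampLieb1976, Thm 4.1 (proof, p. 377)] -/
theorem integral_Ioc_le_right (hf : ∀ x, HasDerivAt f (f' x) x) (hf' : ∀ x, HasDerivAt f' (f'' x) x)
    (hf'' : Continuous f'') (hpos : ∀ x, 0 < f'' x) (ha : ∀ x, f a ≤ f x)
    (hh : ∀ x, HasDerivAt h (h' x) x) (hh' : Continuous h') {s R : ℝ} (hs : a < s) (hsR : s ≤ R) :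
    ∫ x in s..R, (h x - h a) ^ 2 * Real.exp (-f x) ≤
      (∫ x in s..R, (h' x) ^ 2 / f'' x * Real.exp (-f x)) +
        (h s - h a) ^ 2 * Real.exp (-f s) / f' s := by
  have hne : ∀ x ∈ Icc s R, f' x ≠ 0 := fun x hx =>
    (deriv_pos_of_gt hf hf' hpos ha (hs.trans_le hx.1)).ne'
  have key := phi_sub_phi_le (a := a) hf hf' hf'' hpos hh hh' hsR hne
  have hR : 0 ≤ (h R - h a) ^ 2 * Real.exp (-f R) / f' R :=
    div_nonneg (mul_nonneg (sq_nonneg _) (Real.exp_pos _).le)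
      (deriv_pos_of_gt hf hf' hpos ha (hs.trans_le hsR)).le
  linarith

/-- Left of the minimum: for `R ≤ s < a`,
`∫_R^s (h - h a)² e^{-f} ≤ ∫_R^s (h')² e^{-f}/f'' - φ s`. [cite: BrascampLieb1976, Thm 4.1 (proof, p. 377)] -/
theorem integral_Ioc_le_left (hf : ∀ x, HasDerivAt f (f' x) x) (hf' : ∀ x, HasDerivAt f' (f'' x) x)
    (hf'' : Continuous f'') (hpos : ∀ x, 0 < f'' x) (ha : ∀ x, f a ≤ f x)
    (hh : ∀ x, HasDerivAt h (h' x) x) (hh' : Continuous h') {s R : ℝ} (hs : s < a) (hRs : R ≤ s) :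
    ∫ x in R..s, (h x - h a) ^ 2 * Real.exp (-f x) ≤
      (∫ x in R..s, (h' x) ^ 2 / f'' x * Real.exp (-f x)) -
        (h s - h a) ^ 2 * Real.exp (-f s) / f' s := by
  have hne : ∀ x ∈ Icc R s, f' x ≠ 0 := fun x hx =>
    (deriv_neg_of_lt hf hf' hpos ha (hx.2.trans_lt hs)).ne
  have key := phi_sub_phi_le (a := a) hf hf' hf'' hpos hh hh' hRs hne
  have hR : (h R - h a) ^ 2 * Real.exp (-f R) / f' R ≤ 0 :=
    div_nonpos_of_nonneg_of_nonpos (mul_nonneg (sq_nonneg _) (Real.exp_pos _).le)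
      (deriv_neg_of_lt hf hf' hpos ha (hRs.trans_lt hs)).le
  linarith

/-- `φ s = (h s - h a)² e^{-f s} / f' s → 0` as `s → a`, `s ≠ a`: both difference quotients
`(h s - h a)/(s - a) → h' a` and `f' s/(s - a) → f'' a > 0` converge. [folklore] -/
theorem tendsto_phi (hf : ∀ x, HasDerivAt f (f' x) x) (hf' : ∀ x, HasDerivAt f' (f'' x) x)
    (hpos : ∀ x, 0 < f'' x) (ha : ∀ x, f a ≤ f x) (hh : ∀ x, HasDerivAt h (h' x) x) :
    Tendsto (fun s => (h s - h a) ^ 2 * Real.exp (-f s) / f' s) (𝓝[≠] a) (𝓝 0) := by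
  have hfc : Continuous f := continuous_iff_continuousAt.2 fun x => (hf x).continuousAt
  have T1 : Tendsto (slope h a) (𝓝[≠] a) (𝓝 (h' a)) := (hh a).tendsto_slope
  have T2 : Tendsto (slope f' a) (𝓝[≠] a) (𝓝 (f'' a)) := (hf' a).tendsto_slope
  have T2' : Tendsto (fun s => (slope f' a s)⁻¹) (𝓝[≠] a) (𝓝 (f'' a)⁻¹) :=
    T2.inv₀ (hpos a).ne'
  have T3 : Tendsto (fun s : ℝ => s - a) (𝓝[≠] a) (𝓝 0) := by
    have : Tendsto (fun s : ℝ => s - a) (𝓝 a) (𝓝 (a - a)) :=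
      (continuous_id.sub continuous_const).tendsto a
    rw [sub_self] at this
    exact this.mono_left nhdsWithin_le_nhds
  have T4 : Tendsto (fun s => Real.exp (-f s)) (𝓝[≠] a) (𝓝 (Real.exp (-f a))) :=
    ((Real.continuous_exp.comp hfc.neg).tendsto a).mono_left nhdsWithin_le_nhds
  have T := ((T1.pow 2).mul T2').mul (T3.mul T4)
  simp only [zero_mul, mul_zero] at T
  refine T.congr' ?_
  have h0 : f' a = 0 := deriv_eq_zero_of_min hf ha
  filter_upwards [self_mem_nhdsWithin] with s hs
  have hs' : s - a ≠ 0 := sub_ne_zero.2 hs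
  have hfs : f' s ≠ 0 := deriv_ne_zero_of_ne hf hf' hpos ha hs
  rw [slope_def_field, slope_def_field, h0, sub_zero]
  field_simp

/-! ### Passing to the limit: half-lines -/

/-- The right half-line: `∫_{(a,∞)} (h - h a)² e^{-f} ≤ ∫_{(a,∞)} (h')² e^{-f} / f''` (extended
integrals). [cite: BrascampLieb1976, Thm 4.1 (proof, p. 377)] -/
theorem lintegral_Ioi_le (hf : ∀ x, HasDerivAt f (f' x) x) (hf' : ∀ x, HasDerivAt f' (f'' x) x)
    (hf'' : Continuous f'') (hpos : ∀ x, 0 < f'' x) (ha : ∀ x, f a ≤ f x)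
    (hh : ∀ x, HasDerivAt h (h' x) x) (hh' : Continuous h') :
    ∫⁻ x in Ioi a, ENNReal.ofReal ((h x - h a) ^ 2 * Real.exp (-f x)) ≤
      ∫⁻ x in Ioi a, ENNReal.ofReal ((h' x) ^ 2 / f'' x * Real.exp (-f x)) := by
  have hfc : Continuous f := continuous_iff_continuousAt.2 fun x => (hf x).continuousAt
  have hhc : Continuous h := continuous_iff_continuousAt.2 fun x => (hh x).continuousAt
  have hc1 : Continuous fun x => (h' x) ^ 2 / f'' x * Real.exp (-f x) := by
    have h1 : Continuous fun x => (h' x) ^ 2 / f'' x :=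
      (hh'.pow 2).div hf'' fun x => (hpos x).ne'
    fun_prop
  have hc2 : Continuous fun x => (h x - h a) ^ 2 * Real.exp (-f x) := by fun_prop
  set L : ℝ → ℝ := fun x => (h x - h a) ^ 2 * Real.exp (-f x) with hL
  set Rf : ℝ → ℝ := fun x => (h' x) ^ 2 / f'' x * Real.exp (-f x) with hRf
  set φ : ℝ → ℝ := fun s => (h s - h a) ^ 2 * Real.exp (-f s) / f' s with hφ
  have hL0 : ∀ x, 0 ≤ L x := fun x => mul_nonneg (sq_nonneg _) (Real.exp_pos _).le
  have hR0 : ∀ x, 0 ≤ Rf x := fun x =>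
    mul_nonneg (div_nonneg (sq_nonneg _) (hpos x).le) (Real.exp_pos _).le
  set B : ℝ≥0∞ := ∫⁻ x in Ioi a, ENNReal.ofReal (Rf x) with hB
  -- Step 1: bounded intervals.
  have step1 : ∀ s, a < s → ∀ n : ℕ,
      ∫⁻ x in Ioc s (s + n), ENNReal.ofReal (L x) ≤ B + ENNReal.ofReal (φ s) := by
    intro s hs n
    have hsn : s ≤ s + n := le_add_of_nonneg_right n.cast_nonneg
    have hi := integral_Ioc_le_right hf hf' hf'' hpos ha hh hh' hs hsn
    have e1 : ∫⁻ x in Ioc s (s + n), ENNReal.ofReal (L x) = ENNReal.ofReal (∫ x in s..(s + n), L x) := by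
      rw [intervalIntegral.integral_of_le hsn,
        ofReal_integral_eq_lintegral_ofReal (hc2.integrableOn_Icc.mono_set Ioc_subset_Icc_self)
          (ae_of_all _ hL0)]
    have e2 : ENNReal.ofReal (∫ x in s..(s + n), Rf x) = ∫⁻ x in Ioc s (s + n), ENNReal.ofReal (Rf x) := by
      rw [intervalIntegral.integral_of_le hsn,
        ofReal_integral_eq_lintegral_ofReal (hc1.integrableOn_Icc.mono_set Ioc_subset_Icc_self)
          (ae_of_all _ hR0)]
    calc ∫⁻ x in Ioc s (s + n), ENNReal.ofReal (L x)
        = ENNReal.ofReal (∫ x in s..(s + n), L x) := e1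
      _ ≤ ENNReal.ofReal ((∫ x in s..(s + n), Rf x) + φ s) := ENNReal.ofReal_le_ofReal hi
      _ ≤ ENNReal.ofReal (∫ x in s..(s + n), Rf x) + ENNReal.ofReal (φ s) := ENNReal.ofReal_add_le
      _ = (∫⁻ x in Ioc s (s + n), ENNReal.ofReal (Rf x)) + ENNReal.ofReal (φ s) := by rw [e2]
      _ ≤ B + ENNReal.ofReal (φ s) := by
          gcongr
          exact lintegral_mono_set fun x hx => hs.trans hx.1
  -- Step 2: let `R → ∞`.
  have step2 : ∀ s, a < s → ∫⁻ x in Ioi s, ENNReal.ofReal (L x) ≤ B + ENNReal.ofReal (φ s) := by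
    intro s hs
    have hU : (⋃ n : ℕ, Ioc s (s + n)) = Ioi s := by
      ext x
      simp only [mem_iUnion, mem_Ioc, mem_Ioi]
      constructor
      · rintro ⟨n, h1, -⟩; exact h1
      · intro hx
        obtain ⟨n, hn⟩ := exists_nat_ge (x - s)
        exact ⟨n, hx, by linarith⟩
    have hd : Directed (· ⊆ ·) fun n : ℕ => Ioc s (s + n) := by
      refine Monotone.directed_le fun m n hmn => Ioc_subset_Ioc le_rfl ?_
      gcongr
    rw [← hU, setLIntegral_iUnion_of_directed _ hd]
    exact iSup_le fun n => step1 s hs n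
  -- Step 3: let `s → a⁺`.
  set sq : ℕ → ℝ := fun n => a + 1 / ((n : ℝ) + 1) with hsq
  have hsq_gt : ∀ n, a < sq n := fun n => by
    simp only [hsq]; have : (0 : ℝ) < 1 / ((n : ℝ) + 1) := by positivity
    linarith
  have hsq_tend : Tendsto sq atTop (𝓝[≠] a) := by
    refine tendsto_nhdsWithin_iff.2 ⟨?_, Eventually.of_forall fun n => (hsq_gt n).ne'⟩
    have : Tendsto (fun n : ℕ => a + 1 / ((n : ℝ) + 1)) atTop (𝓝 (a + 0)) :=
      tendsto_const_nhds.add tendsto_one_div_add_atTop_nhds_zero_nat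
    rwa [add_zero] at this
  have hφ0 : Tendsto (fun n => ENNReal.ofReal (φ (sq n))) atTop (𝓝 0) := by
    have := (tendsto_phi hf hf' hpos ha hh).comp hsq_tend
    have := ENNReal.tendsto_ofReal this
    rwa [ENNReal.ofReal_zero] at this
  have hlim : Tendsto (fun n => B + ENNReal.ofReal (φ (sq n))) atTop (𝓝 B) := by
    have := (tendsto_const_nhds (x := B)).add hφ0
    rwa [add_zero] at this
  have hU : (⋃ n : ℕ, Ioi (sq n)) = Ioi a := by
    ext x
    simp only [mem_iUnion, mem_Ioi]
    constructor
    · rintro ⟨n, hn⟩; exact (hsq_gt n).trans hn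
    · intro hx
      obtain ⟨n, hn⟩ := exists_nat_gt (1 / (x - a))
      refine ⟨n, ?_⟩
      simp only [hsq]
      have hxa : 0 < x - a := sub_pos.2 hx
      have : 1 / ((n : ℝ) + 1) < x - a := by
        rw [div_lt_iff₀ (by positivity)]
        have := (div_lt_iff₀ hxa).1 hn
        nlinarith
      linarith
  have hanti : ∀ m n, m ≤ n → sq n ≤ sq m := fun m n hmn => by
    simp only [hsq]
    gcongr
  have hd : Directed (· ⊆ ·) fun n : ℕ => Ioi (sq n) :=
    Monotone.directed_le fun m n hmn => Ioi_subset_Ioi (hanti m n hmn)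
  rw [← hU, setLIntegral_iUnion_of_directed _ hd]
  refine iSup_le fun n => ?_
  refine ge_of_tendsto hlim ?_
  filter_upwards [eventually_ge_atTop n] with m hm
  calc ∫⁻ x in Ioi (sq n), ENNReal.ofReal (L x)
      ≤ ∫⁻ x in Ioi (sq m), ENNReal.ofReal (L x) := lintegral_mono_set (Ioi_subset_Ioi (hanti n m hm))
    _ ≤ B + ENNReal.ofReal (φ (sq m)) := step2 _ (hsq_gt m)

/-- The left half-line: `∫_{(-∞,a)} (h - h a)² e^{-f} ≤ ∫_{(-∞,a)} (h')² e^{-f} / f''`.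
[cite: BrascampLieb1976, Thm 4.1 (proof, p. 377)] -/
theorem lintegral_Iio_le (hf : ∀ x, HasDerivAt f (f' x) x) (hf' : ∀ x, HasDerivAt f' (f'' x) x)
    (hf'' : Continuous f'') (hpos : ∀ x, 0 < f'' x) (ha : ∀ x, f a ≤ f x)
    (hh : ∀ x, HasDerivAt h (h' x) x) (hh' : Continuous h') :
    ∫⁻ x in Iio a, ENNReal.ofReal ((h x - h a) ^ 2 * Real.exp (-f x)) ≤
      ∫⁻ x in Iio a, ENNReal.ofReal ((h' x) ^ 2 / f'' x * Real.exp (-f x)) := by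
  have hfc : Continuous f := continuous_iff_continuousAt.2 fun x => (hf x).continuousAt
  have hhc : Continuous h := continuous_iff_continuousAt.2 fun x => (hh x).continuousAt
  have hc1 : Continuous fun x => (h' x) ^ 2 / f'' x * Real.exp (-f x) := by
    have h1 : Continuous fun x => (h' x) ^ 2 / f'' x :=
      (hh'.pow 2).div hf'' fun x => (hpos x).ne'
    fun_prop
  have hc2 : Continuous fun x => (h x - h a) ^ 2 * Real.exp (-f x) := by fun_prop
  set L : ℝ → ℝ := fun x => (h x - h a) ^ 2 * Real.exp (-f x) with hL
  set Rf : ℝ → ℝ := fun x => (h' x) ^ 2 / f'' x * Real.exp (-f x) with hRf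
  set φ : ℝ → ℝ := fun s => (h s - h a) ^ 2 * Real.exp (-f s) / f' s with hφ
  have hL0 : ∀ x, 0 ≤ L x := fun x => mul_nonneg (sq_nonneg _) (Real.exp_pos _).le
  have hR0 : ∀ x, 0 ≤ Rf x := fun x =>
    mul_nonneg (div_nonneg (sq_nonneg _) (hpos x).le) (Real.exp_pos _).le
  set B : ℝ≥0∞ := ∫⁻ x in Iio a, ENNReal.ofReal (Rf x) with hB
  -- Step 1: bounded intervals `(s - n, s]`.
  have step1 : ∀ s, s < a → ∀ n : ℕ,
      ∫⁻ x in Ioc (s - n) s, ENNReal.ofReal (L x) ≤ B + ENNReal.ofReal (-φ s) := by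
    intro s hs n
    have hsn : s - n ≤ s := sub_le_self _ n.cast_nonneg
    have hi := integral_Ioc_le_left hf hf' hf'' hpos ha hh hh' hs hsn
    have e1 : ∫⁻ x in Ioc (s - n) s, ENNReal.ofReal (L x) = ENNReal.ofReal (∫ x in (s - n)..s, L x) := by
      rw [intervalIntegral.integral_of_le hsn,
        ofReal_integral_eq_lintegral_ofReal (hc2.integrableOn_Icc.mono_set Ioc_subset_Icc_self)
          (ae_of_all _ hL0)]
    have e2 : ENNReal.ofReal (∫ x in (s - n)..s, Rf x) = ∫⁻ x in Ioc (s - n) s, ENNReal.ofReal (Rf x) := by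
      rw [intervalIntegral.integral_of_le hsn,
        ofReal_integral_eq_lintegral_ofReal (hc1.integrableOn_Icc.mono_set Ioc_subset_Icc_self)
          (ae_of_all _ hR0)]
    have hsub : Ioc (s - n) s ⊆ Iio a := fun x hx => hx.2.trans_lt hs
    calc ∫⁻ x in Ioc (s - n) s, ENNReal.ofReal (L x)
        = ENNReal.ofReal (∫ x in (s - n)..s, L x) := e1
      _ ≤ ENNReal.ofReal ((∫ x in (s - n)..s, Rf x) + -φ s) := by
          exact ENNReal.ofReal_le_ofReal (hi.trans (le_of_eq (sub_eq_add_neg _ _)))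
      _ ≤ ENNReal.ofReal (∫ x in (s - n)..s, Rf x) + ENNReal.ofReal (-φ s) := ENNReal.ofReal_add_le
      _ = (∫⁻ x in Ioc (s - n) s, ENNReal.ofReal (Rf x)) + ENNReal.ofReal (-φ s) := by rw [e2]
      _ ≤ B + ENNReal.ofReal (-φ s) := by
          gcongr
          exact lintegral_mono_set hsub
  -- Step 2: `R → -∞`.
  have step2 : ∀ s, s < a → ∫⁻ x in Iic s, ENNReal.ofReal (L x) ≤ B + ENNReal.ofReal (-φ s) := by
    intro s hs
    have hU : (⋃ n : ℕ, Ioc (s - n) s) = Iic s := by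
      ext x
      simp only [mem_iUnion, mem_Ioc, mem_Iic]
      constructor
      · rintro ⟨n, -, h2⟩; exact h2
      · intro hx
        obtain ⟨n, hn⟩ := exists_nat_gt (s - x)
        exact ⟨n, by linarith, hx⟩
    have hd : Directed (· ⊆ ·) fun n : ℕ => Ioc (s - n) s := by
      refine Monotone.directed_le fun m n hmn => Ioc_subset_Ioc ?_ le_rfl
      gcongr
    rw [← hU, setLIntegral_iUnion_of_directed _ hd]
    exact iSup_le fun n => step1 s hs n
  -- Step 3: `s → a⁻`.
  set sq : ℕ → ℝ := fun n => a - 1 / ((n : ℝ) + 1) with hsq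
  have hsq_lt : ∀ n, sq n < a := fun n => by
    simp only [hsq]; have : (0 : ℝ) < 1 / ((n : ℝ) + 1) := by positivity
    linarith
  have hsq_tend : Tendsto sq atTop (𝓝[≠] a) := by
    refine tendsto_nhdsWithin_iff.2 ⟨?_, Eventually.of_forall fun n => (hsq_lt n).ne⟩
    have : Tendsto (fun n : ℕ => a - 1 / ((n : ℝ) + 1)) atTop (𝓝 (a - 0)) :=
      tendsto_const_nhds.sub tendsto_one_div_add_atTop_nhds_zero_nat
    rwa [sub_zero] at this
  have hφ0 : Tendsto (fun n => ENNReal.ofReal (-φ (sq n))) atTop (𝓝 0) := by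
    have := ((tendsto_phi hf hf' hpos ha hh).comp hsq_tend).neg
    rw [neg_zero] at this
    have := ENNReal.tendsto_ofReal this
    rwa [ENNReal.ofReal_zero] at this
  have hlim : Tendsto (fun n => B + ENNReal.ofReal (-φ (sq n))) atTop (𝓝 B) := by
    have := (tendsto_const_nhds (x := B)).add hφ0
    rwa [add_zero] at this
  have hU : (⋃ n : ℕ, Iic (sq n)) = Iio a := by
    ext x
    simp only [mem_iUnion, mem_Iic, mem_Iio]
    constructor
    · rintro ⟨n, hn⟩; exact hn.trans_lt (hsq_lt n)
    · intro hx
      obtain ⟨n, hn⟩ := exists_nat_gt (1 / (a - x))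
      refine ⟨n, ?_⟩
      simp only [hsq]
      have hxa : 0 < a - x := sub_pos.2 hx
      have : 1 / ((n : ℝ) + 1) < a - x := by
        rw [div_lt_iff₀ (by positivity)]
        have := (div_lt_iff₀ hxa).1 hn
        nlinarith
      linarith
  have hmono : ∀ m n, m ≤ n → sq m ≤ sq n := fun m n hmn => by
    simp only [hsq]
    gcongr
  have hd : Directed (· ⊆ ·) fun n : ℕ => Iic (sq n) :=
    Monotone.directed_le fun m n hmn => Iic_subset_Iic.2 (hmono m n hmn)
  rw [← hU, setLIntegral_iUnion_of_directed _ hd]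
  refine iSup_le fun n => ?_
  refine ge_of_tendsto hlim ?_
  filter_upwards [eventually_ge_atTop n] with m hm
  calc ∫⁻ x in Iic (sq n), ENNReal.ofReal (L x)
      ≤ ∫⁻ x in Iic (sq m), ENNReal.ofReal (L x) := lintegral_mono_set (Iic_subset_Iic.2 (hmono n m hm))
    _ ≤ B + ENNReal.ofReal (-φ (sq m)) := step2 _ (hsq_lt m)

/-- **Brascamp–Lieb in dimension one, unnormalised form.** For `f ∈ C²(ℝ)` with `f'' > 0`
attaining its minimum at `a`, and `h ∈ C¹(ℝ)`:
`∫ (h - h a)² e^{-f} dx ≤ ∫ (h')² / f'' · e^{-f} dx` (extended integrals).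
[cite: BrascampLieb1976, Thm 4.1 (proof for ℝ¹, p. 377)] -/
theorem lintegral_sq_sub_le (hf : ∀ x, HasDerivAt f (f' x) x) (hf' : ∀ x, HasDerivAt f' (f'' x) x)
    (hf'' : Continuous f'') (hpos : ∀ x, 0 < f'' x) (ha : ∀ x, f a ≤ f x)
    (hh : ∀ x, HasDerivAt h (h' x) x) (hh' : Continuous h') :
    ∫⁻ x, ENNReal.ofReal ((h x - h a) ^ 2 * Real.exp (-f x)) ≤
      ∫⁻ x, ENNReal.ofReal ((h' x) ^ 2 / f'' x * Real.exp (-f x)) := by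
  rw [← lintegral_add_compl (μ := volume)
      (fun x => ENNReal.ofReal ((h x - h a) ^ 2 * Real.exp (-f x))) measurableSet_Iic,
    ← lintegral_add_compl (μ := volume)
      (fun x => ENNReal.ofReal ((h' x) ^ 2 / f'' x * Real.exp (-f x))) measurableSet_Iic,
    compl_Iic, setLIntegral_congr (Iio_ae_eq_Iic (μ := volume) (a := a)).symm,
    setLIntegral_congr (Iio_ae_eq_Iic (μ := volume) (a := a)).symm]
  exact add_le_add (lintegral_Iio_le hf hf' hf'' hpos ha hh hh')
    (lintegral_Ioi_le hf hf' hf'' hpos ha hh hh')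

/-! ### Finiteness of `∫ e^{-f}` -/

/-- A `C²` function on `ℝ` with `f'' > 0` and a minimum grows at least linearly:
`∫ e^{-f} < ∞`. [cite: BrascampLieb1976, Thm 4.1 (statement, p. 375)] -/
theorem lintegral_exp_neg_lt_top (hf : ∀ x, HasDerivAt f (f' x) x)
    (hf' : ∀ x, HasDerivAt f' (f'' x) x) (hpos : ∀ x, 0 < f'' x) (ha : ∀ x, f a ≤ f x) :
    ∫⁻ x, ENNReal.ofReal (Real.exp (-f x)) < ∞ := by
  have hfc : Continuous f := continuous_iff_continuousAt.2 fun x => (hf x).continuousAt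
  have hdiff : Differentiable ℝ f := fun x => (hf x).differentiableAt
  have hderiv : ∀ x, deriv f x = f' x := fun x => (hf x).deriv
  -- it suffices to show integrability of `e^{-f}`
  suffices hint : Integrable (fun x => Real.exp (-f x)) by
    have := hint.2
    simpa [hasFiniteIntegral_iff_enorm, Real.enorm_eq_ofReal (Real.exp_pos _).le] using this
  have hmono := strictMono_of_hasDerivAt_pos hf' hpos
  set mp : ℝ := f' (a + 1) with hmp
  set mm : ℝ := f' (a - 1) with hmm
  have hmp_pos : 0 < mp := deriv_pos_of_gt hf hf' hpos ha (by linarith)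
  have hmm_neg : mm < 0 := deriv_neg_of_lt hf hf' hpos ha (by linarith)
  -- on `[a+1, ∞)`: `f x ≥ f (a+1) + mp (x - (a+1))`
  have hright : ∀ x, a + 1 ≤ x → mp * (x - (a + 1)) ≤ f x - f (a + 1) := by
    intro x hx
    refine (convex_Ici (a + 1)).mul_sub_le_image_sub_of_le_deriv hfc.continuousOn
      (hdiff.differentiableOn) (fun y hy => ?_) (a + 1) Set.self_mem_Ici x (Set.mem_Ici.2 hx) hx
    rw [interior_Ici] at hy
    rw [hderiv]
    exact (hmono.monotone (le_of_lt hy))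
  -- on `(-∞, a-1]`: `f (a-1) - f x ≤ mm ((a - 1) - x)`, i.e. `f x ≥ f (a-1) + (-mm) ((a-1) - x)`
  have hleft : ∀ x, x ≤ a - 1 → f (a - 1) - f x ≤ mm * ((a - 1) - x) := by
    intro x hx
    refine (convex_Iic (a - 1)).image_sub_le_mul_sub_of_deriv_le hfc.continuousOn
      (hdiff.differentiableOn) (fun y hy => ?_) x (Set.mem_Iic.2 hx) (a - 1) Set.self_mem_Iic hx
    rw [interior_Iic] at hy
    rw [hderiv]
    exact (hmono.monotone (le_of_lt hy))
  -- integrability on the three pieces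
  have I1 : IntegrableOn (fun x => Real.exp (-f x)) (Icc (a - 1) (a + 1)) :=
    (by fun_prop : Continuous fun x => Real.exp (-f x)).integrableOn_Icc
  have I2 : IntegrableOn (fun x => Real.exp (-f x)) (Ioi (a + 1)) := by
    have hdom : IntegrableOn (fun x => Real.exp (-f (a + 1) + mp * (a + 1)) * Real.exp (-mp * x))
        (Ioi (a + 1)) :=
      ((integrableOn_exp_mul_Ioi (neg_neg_of_pos hmp_pos) (a + 1)).const_mul _)
    refine hdom.mono' (by fun_prop) ?_
    refine (ae_restrict_iff' (μ := volume) measurableSet_Ioi).2 (ae_of_all _ fun x hx => ?_)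
    rw [Real.norm_eq_abs, abs_of_pos (Real.exp_pos _), ← Real.exp_add]
    refine Real.exp_le_exp.2 ?_
    have := hright x (le_of_lt hx)
    nlinarith
  have I3 : IntegrableOn (fun x => Real.exp (-f x)) (Iic (a - 1)) := by
    have hdom : IntegrableOn (fun x => Real.exp (-f (a - 1) + mm * (a - 1)) * Real.exp (-mm * x))
        (Iic (a - 1)) :=
      ((integrableOn_exp_mul_Iic (neg_pos_of_neg hmm_neg) (a - 1)).const_mul _)
    refine hdom.mono' (by fun_prop) ?_
    refine (ae_restrict_iff' (μ := volume) measurableSet_Iic).2 (ae_of_all _ fun x hx => ?_)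
    rw [Real.norm_eq_abs, abs_of_pos (Real.exp_pos _), ← Real.exp_add]
    refine Real.exp_le_exp.2 ?_
    have := hleft x hx
    nlinarith
  have hunion : (Iic (a - 1) ∪ Icc (a - 1) (a + 1)) ∪ Ioi (a + 1) = univ := by
    ext x
    simp only [mem_union, mem_Iic, mem_Icc, mem_Ioi, mem_univ, iff_true]
    rcases le_or_gt x (a - 1) with h1 | h1
    · exact Or.inl (Or.inl h1)
    · rcases le_or_gt x (a + 1) with h2 | h2
      · exact Or.inl (Or.inr ⟨h1.le, h2⟩)
      · exact Or.inr h2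
  have := (I3.union I1).union I2
  rwa [hunion, integrableOn_univ] at this

/-- `∫ e^{-f} ≠ 0`. [folklore] -/
theorem lintegral_exp_neg_ne_zero (hf : ∀ x, HasDerivAt f (f' x) x) :
    ∫⁻ x, ENNReal.ofReal (Real.exp (-f x)) ≠ 0 := by
  have hfc : Continuous f := continuous_iff_continuousAt.2 fun x => (hf x).continuousAt
  have hsupp : Function.support (fun x => ENNReal.ofReal (Real.exp (-f x))) = univ := by
    ext x
    simp [Real.exp_pos]
  refine ((lintegral_pos_iff_support (by fun_prop)).2 ?_).ne'
  rw [hsupp, Real.volume_univ]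
  exact ENNReal.zero_lt_top

/-! ### The probabilistic statement -/

/-- **Brascamp–Lieb 1976, Theorem 4.1, for `n = 1`.** Let `f ∈ C²(ℝ)` with `f'' > 0` attain
its minimum (at `a`), let `μ = e^{-f} dx / ∫ e^{-f}` and let `h ∈ C¹(ℝ)` with `h ∈ L²(μ)`. Then
`var_μ h ≤ ∫ (h')² / f'' dμ`. The measure is given explicitly as the normalised density
`e^{-f}`; derivatives are supplied pointwise (`HasDerivAt`).
[cite: BrascampLieb1976, Thm 4.1 (n = 1)] -/
theorem evariance_le (hf : ∀ x, HasDerivAt f (f' x) x) (hf' : ∀ x, HasDerivAt f' (f'' x) x)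
    (hf'' : Continuous f'') (hpos : ∀ x, 0 < f'' x) (ha : ∀ x, f a ≤ f x)
    (hh : ∀ x, HasDerivAt h (h' x) x) (hh' : Continuous h')
    (μ : Measure ℝ)
    (hμ : μ = (∫⁻ x, ENNReal.ofReal (Real.exp (-f x)))⁻¹ •
      volume.withDensity (fun x => ENNReal.ofReal (Real.exp (-f x))))
    (hmem : MemLp h 2 μ) :
    evariance h μ ≤ ∫⁻ x, ENNReal.ofReal ((h' x) ^ 2 / f'' x) ∂μ := by
  have hfc : Continuous f := continuous_iff_continuousAt.2 fun x => (hf x).continuousAt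
  have hhc : Continuous h := continuous_iff_continuousAt.2 fun x => (hh x).continuousAt
  set Z : ℝ≥0∞ := ∫⁻ x, ENNReal.ofReal (Real.exp (-f x)) with hZ
  have hZtop : Z ≠ ∞ := (lintegral_exp_neg_lt_top hf hf' hpos ha).ne
  have hZ0 : Z ≠ 0 := lintegral_exp_neg_ne_zero hf
  have hdens : Measurable fun x => ENNReal.ofReal (Real.exp (-f x)) := by fun_prop
  haveI : IsProbabilityMeasure μ := by
    constructor
    rw [hμ, Measure.smul_apply, withDensity_apply _ MeasurableSet.univ, Measure.restrict_univ,
      smul_eq_mul, ENNReal.inv_mul_cancel hZ0 hZtop]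
  -- variance ≤ second moment about `h a`
  have hX : AEStronglyMeasurable h μ := hhc.aestronglyMeasurable
  have h1 : evariance h μ ≤ ∫⁻ x, ENNReal.ofReal ((h x - h a) ^ 2) ∂μ := by
    rw [← ofReal_variance hmem, ← variance_sub_const hX (h a)]
    have hmem' : MemLp (fun x => h x - h a) 2 μ := hmem.sub (memLp_const _)
    have hle := variance_le_expectation_sq (μ := μ) (X := fun x => h x - h a)
      (hX.sub aestronglyMeasurable_const)
    have hint : Integrable (fun x => (h x - h a) ^ 2) μ := hmem'.integrable_sq
    calc ENNReal.ofReal (variance (fun x => h x - h a) μ)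
        ≤ ENNReal.ofReal (∫ x, (h x - h a) ^ 2 ∂μ) := by
          refine ENNReal.ofReal_le_ofReal ?_
          simpa [Pi.pow_apply] using hle
      _ = ∫⁻ x, ENNReal.ofReal ((h x - h a) ^ 2) ∂μ :=
          ofReal_integral_eq_lintegral_ofReal hint (ae_of_all _ fun x => sq_nonneg _)
  -- rewrite both sides as weighted Lebesgue integrals
  have h2 : ∫⁻ x, ENNReal.ofReal ((h x - h a) ^ 2) ∂μ =
      Z⁻¹ * ∫⁻ x, ENNReal.ofReal ((h x - h a) ^ 2 * Real.exp (-f x)) := by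
    rw [hμ, lintegral_smul_measure, lintegral_withDensity_eq_lintegral_mul _ hdens (by fun_prop)]
    congr 1
    refine lintegral_congr fun x => ?_
    simp only [Pi.mul_apply]
    rw [← ENNReal.ofReal_mul (Real.exp_pos _).le, mul_comm]
  have h3 : ∫⁻ x, ENNReal.ofReal ((h' x) ^ 2 / f'' x) ∂μ =
      Z⁻¹ * ∫⁻ x, ENNReal.ofReal ((h' x) ^ 2 / f'' x * Real.exp (-f x)) := by
    rw [hμ, lintegral_smul_measure, lintegral_withDensity_eq_lintegral_mul _ hdens]
    · congr 1
      refine lintegral_congr fun x => ?_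
      simp only [Pi.mul_apply]
      rw [← ENNReal.ofReal_mul (Real.exp_pos _).le, mul_comm]
    · have : Measurable fun x => (h' x) ^ 2 / f'' x :=
        ((hh'.pow 2).div hf'' fun x => (hpos x).ne').measurable
      exact this.ennreal_ofReal
  rw [h3]
  refine h1.trans ?_
  rw [h2]
  exact mul_le_mul_right (lintegral_sq_sub_le hf hf' hf'' hpos ha hh hh') _

end Setting

end BrascampLiebDimOne

end Literature.Probability.Distributions
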